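import Summits.MatrixMultiplication.MatrixMultiplication.Theorems.ObstructionDescentUniversalOccurrenceTwoRectangleQuadFrontTableaux
import Summits.MatrixMultiplication.MatrixMultiplication.Theorems.ObstructionDescentUniversalOccurrenceTwoRectangleQuadFrontArith

set_option linter.dupNamespace false
set_option autoImplicit false

/-!
# Universal occurrence — two rectangles, FOUR-ROW TYPES `(2N-2k-6, 2k+2, 2, 2)`, part V: the value of a valid term (decomp-mm · lens 3 · gen 43)

Route `route-MatrixMultiplication-ObstructionDescent` (sub-problem `MatrixMultiplication`, `ω(ℂ) = 2`); SUPPORT for the crux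
`NoOccurrenceObstruction` (`P_O`, item `stmt-MatrixMultiplication-29040`) through the universal-occurrence programme (NODE-g29…g43
of the decomp-mm cell, lens 3).  Nothing here proves `ω = 2` or closes an item; no `def`, no `sorry`, standard axioms.

**The quad-front design** (K23 floor law, `δ = 2`, twist `H = {s₁, s₃}`): `M = e_T` for the quad-front tableau (part T); colouring
`g = (0,1,2,3, 0,1, …, 0,…)` (`k` pairs); block structure `p ↦ (X(p) mod 2, ⌊X(p)/2⌋)` with `X = (4 5)(6 7) · ∏_{j<k} (4j+10 4j+11)`,
i.e. core columns `[(0,s₀),(1,s₀),(0,s₁),(1,s₁)] ‖ [(1,s₂),(0,s₂),(1,s₃),(0,s₃)]` and `[(0,s_{2j+4}),(1,s_{2j+4})] ‖ [(1,s_{2j+5}),(0,s_{2j+5})]`.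

**Claim** (`quadFront_value_eq_one`).  For every VALID `σ` (`σ₀⁻¹σ₁` stabilises `H`), `e_T(g ∘ w_σ) ∈ {0,1}`.  Proof: support ⟹
letters; validity inside column `0` forces `B₁ = A₃`, `B₃ = A₁`; the letters `2, 3` occur once per block; the front pair is a twin or
an anti-twin with `A₀ + B₀ = 1` (`quadFront_local_configurations`); the parity law with remainder gives `#anti pairs ≡ [front anti]
(mod 2)`, so the product of the transpositions `(4j+10 4j+11)` over the anti pairs, times `(4 5)` if the front pair is anti, is an
EVEN element of `C(T)` turning `g ∘ w_σ` into a twin word (`quadFrontTableau_twin_eq_one`).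

[cite: BurgisserIkenmeyer2011, §3.4 (Prop. 3.4), Thm. 4.4] [cite: BurgisserIkenmeyer2017, §5, Thm. 5.9 (proof of (2)), eq. (3.4)]
-/

noncomputable section

open scoped BigOperators

namespace Summit.MatrixMultiplication.MatrixMultiplication.Theorems.ObstructionCalculus

open Literature.Computability.AlgebraicComplexity
open Literature.NumberTheory.DiophantineGeometry

set_option maxHeartbeats 800000 in
/-- **A valid term of the quad-front design has `e_T(g ∘ w_σ) ∈ {0, 1}`.** [cite: BurgisserIkenmeyer2011, Thm. 4.4]
[cite: BurgisserIkenmeyer2017, Thm. 5.9 (proof of (2))] -/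
theorem quadFront_value_eq_one {N k : ℕ} (hN : 2 * k + 4 ≤ N) {Y : YoungDiagram}
    (hNY : ∀ x ∈ Y.cells, x.1 < N) (T : StdFilling (N * 2) Y)
    (hT : ∀ p : Fin (N * 2), T.1 p = (if (p : ℕ) < 8 then ((p : ℕ) % 4, (p : ℕ) / 4)
      else if (p : ℕ) < 4 * k + 8 then ((p : ℕ) % 2, (p : ℕ) / 2 - 2) else (0, (p : ℕ) - 2 * k - 6)))
    (e : Fin (N * 2) ≃ Fin 2 × Fin N) (g : Fin N → Fin N)
    (hgv : ∀ i : Fin N, ((g i : Fin N) : ℕ) = if (i : ℕ) < 4 then (i : ℕ)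
      else if ((i : ℕ) < 2 * k + 4 ∧ (i : ℕ) % 2 = 1) then 1 else 0)
    (hpos : ∀ (σ : Fin 2 → Equiv.Perm (Fin N)) (n : ℕ) (hn : n < N * 2) (a : Fin 2) (s : Fin N),
      (if (4 ≤ n ∧ n < 8 ∧ n % 2 = 0) then n + 1 else if (4 ≤ n ∧ n < 8 ∧ n % 2 = 1) then n - 1
        else if (8 ≤ n ∧ n < 4 * k + 8 ∧ n % 4 = 2) then n + 1
        else if (8 ≤ n ∧ n < 4 * k + 8 ∧ n % 4 = 3) then n - 1 else n) % 2 = (a : ℕ) →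
      (if (4 ≤ n ∧ n < 8 ∧ n % 2 = 0) then n + 1 else if (4 ≤ n ∧ n < 8 ∧ n % 2 = 1) then n - 1
        else if (8 ≤ n ∧ n < 4 * k + 8 ∧ n % 4 = 2) then n + 1
        else if (8 ≤ n ∧ n < 4 * k + 8 ∧ n % 4 = 3) then n - 1 else n) / 2 = (s : ℕ) →
      (g ∘ fun q => σ (e q).1 (e q).2) ⟨n, hn⟩ = g (σ a s))
    (H : Finset (Fin N)) (hHv : ∀ s : Fin N, s ∈ H ↔ ((s : ℕ) = 1 ∨ (s : ℕ) = 3))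
    (s1 s3 : Fin N) (hs1 : (s1 : ℕ) = 1) (hs3 : (s3 : ℕ) = 3)
    (σ : Fin 2 → Equiv.Perm (Fin N)) (hval : ∀ s, (σ 0)⁻¹ (σ 1 s) ∈ H ↔ s ∈ H)
    (hz : T.polytabloid ℂ hNY (g ∘ fun q => σ (e q).1 (e q).2) ≠ 0) :
    T.polytabloid ℂ hNY (g ∘ fun q => σ (e q).1 (e q).2) = 1 := by
  classical
  set v := (g ∘ fun q => σ (e q).1 (e q).2) with hv
  have hcolT : ∀ q : Fin (N * 2), (T.1 q).2 =
      if (q : ℕ) < 8 then (q : ℕ) / 4 else if (q : ℕ) < 4 * k + 8 then (q : ℕ) / 2 - 2 else (q : ℕ) - 2 * k - 6 :=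
    fun q => by rw [hT]; split_ifs <;> rfl
  obtain ⟨harm, hlt4, hlt2, hinj⟩ := quadFrontTableau_support hNY T hT hz
  have hNpos : 0 < N * 2 := by omega
  let P : ℕ → Fin (N * 2) := fun n => ⟨n % (N * 2), Nat.mod_lt _ hNpos⟩
  have hP : ∀ n, n < N * 2 → ((P n : Fin (N * 2)) : ℕ) = n := fun n hn => Nat.mod_eq_of_lt hn
  let U : ℕ → ℕ := fun n => ((v (P n) : Fin N) : ℕ)
  have hU : ∀ (n : ℕ) (hn : n < N * 2), ((v ⟨n, hn⟩ : Fin N) : ℕ) = U n := by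
    intro n hn
    show _ = ((v (P n) : Fin N) : ℕ)
    rw [show (⟨n, hn⟩ : Fin (N * 2)) = P n from Fin.ext (hP n hn).symm]
  have hUp : ∀ x : Fin (N * 2), ((v x : Fin N) : ℕ) = U x := fun x => hU x.1 x.2
  have hU4 : ∀ n, U n < 4 := fun n => hlt4 _
  have hU2 : ∀ n, 8 ≤ n → n < N * 2 → U n < 2 := fun n h8 hn => hlt2 _ (by rw [hP n hn]; exact h8)
  -- letters in one column are distinct
  have hcolne : ∀ n n', n < N * 2 → n' < N * 2 → n ≠ n' →
      (if n < 8 then n / 4 else if n < 4 * k + 8 then n / 2 - 2 else n - 2 * k - 6) =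
        (if n' < 8 then n' / 4 else if n' < 4 * k + 8 then n' / 2 - 2 else n' - 2 * k - 6) → U n ≠ U n' := by
    intro n n' hn hn' hne hc h
    have h' : v (P n) = v (P n') := Fin.ext h
    have := hinj (P n) (P n') (by rw [hcolT, hcolT, hP _ hn, hP _ hn']; exact hc) h'
    have := congrArg Fin.val this
    rw [hP _ hn, hP _ hn'] at this
    exact hne this
  have d01 := hcolne 0 1 (by omega) (by omega) (by omega) (by simp)
  have d02 := hcolne 0 2 (by omega) (by omega) (by omega) (by simp)
  have d03 := hcolne 0 3 (by omega) (by omega) (by omega) (by simp)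
  have d12 := hcolne 1 2 (by omega) (by omega) (by omega) (by simp)
  have d13 := hcolne 1 3 (by omega) (by omega) (by omega) (by simp)
  have d23 := hcolne 2 3 (by omega) (by omega) (by omega) (by simp)
  have d45 := hcolne 4 5 (by omega) (by omega) (by omega) (by simp)
  have d46 := hcolne 4 6 (by omega) (by omega) (by omega) (by simp)
  have d47 := hcolne 4 7 (by omega) (by omega) (by omega) (by simp)
  have d56 := hcolne 5 6 (by omega) (by omega) (by omega) (by simp)
  have d57 := hcolne 5 7 (by omega) (by omega) (by omega) (by simp)
  have hc0 : ∀ j < k, U (4 * j + 8) + U (4 * j + 9) = 1 := by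
    intro j hj
    have := hcolne (4 * j + 8) (4 * j + 9) (by omega) (by omega) (by omega) (by split_ifs <;> omega)
    have := hU2 (4 * j + 8) (by omega) (by omega); have := hU2 (4 * j + 9) (by omega) (by omega); omega
  have hc1 : ∀ j < k, U (4 * j + 10) + U (4 * j + 11) = 1 := by
    intro j hj
    have := hcolne (4 * j + 10) (4 * j + 11) (by omega) (by omega) (by omega) (by split_ifs <;> omega)
    have := hU2 (4 * j + 10) (by omega) (by omega); have := hU2 (4 * j + 11) (by omega) (by omega); omega
  -- reading the letters through `hpos`
  have rd : ∀ (n : ℕ) (hn : n < N * 2) (a : Fin 2) (s : Fin N),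
      (if (4 ≤ n ∧ n < 8 ∧ n % 2 = 0) then n + 1 else if (4 ≤ n ∧ n < 8 ∧ n % 2 = 1) then n - 1
        else if (8 ≤ n ∧ n < 4 * k + 8 ∧ n % 4 = 2) then n + 1
        else if (8 ≤ n ∧ n < 4 * k + 8 ∧ n % 4 = 3) then n - 1 else n) % 2 = (a : ℕ) →
      (if (4 ≤ n ∧ n < 8 ∧ n % 2 = 0) then n + 1 else if (4 ≤ n ∧ n < 8 ∧ n % 2 = 1) then n - 1
        else if (8 ≤ n ∧ n < 4 * k + 8 ∧ n % 4 = 2) then n + 1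
        else if (8 ≤ n ∧ n < 4 * k + 8 ∧ n % 4 = 3) then n - 1 else n) / 2 = (s : ℕ) →
      U n = ((g (σ a s) : Fin N) : ℕ) := by
    intro n hn a s ha hs
    rw [← hU n hn]
    exact congrArg Fin.val (by rw [hv]; exact hpos σ n hn a s ha hs)
  -- validity inside column `0`: `B₁ = A₃` and `B₃ = A₁`
  have hi0 : ∀ x, σ 0 ((σ 0)⁻¹ x) = x := fun x => (σ 0).apply_symm_apply x
  obtain ⟨v1, v3⟩ : U 3 = U 7 ∧ U 6 = U 2 := by
    obtain ⟨t1, ht1⟩ : ∃ t, σ 0 t = σ 1 s1 := ⟨_, hi0 _⟩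
    obtain ⟨t3, ht3⟩ : ∃ t, σ 0 t = σ 1 s3 := ⟨_, hi0 _⟩
    have k1 : (σ 0)⁻¹ (σ 1 s1) = t1 := (σ 0).injective (by rw [hi0, ht1])
    have k3 : (σ 0)⁻¹ (σ 1 s3) = t3 := (σ 0).injective (by rw [hi0, ht3])
    have m1 : (t1 : ℕ) = 1 ∨ (t1 : ℕ) = 3 :=
      (hHv t1).1 (by rw [← k1]; exact (hval s1).2 ((hHv s1).2 (Or.inl hs1)))
    have m3 : (t3 : ℕ) = 1 ∨ (t3 : ℕ) = 3 :=
      (hHv t3).1 (by rw [← k3]; exact (hval s3).2 ((hHv s3).2 (Or.inr hs3)))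
    have hne : (t1 : ℕ) ≠ (t3 : ℕ) := fun h => by
      have h' : σ 1 s1 = σ 1 s3 := by rw [← ht1, ← ht3, show t1 = t3 from Fin.ext h]
      have := congrArg Fin.val ((σ 1).injective h')
      rw [hs1, hs3] at this; omega
    have r3 := rd 3 (by omega) 1 s1 (by simp) (by simp [hs1])
    have r2 := rd 2 (by omega) 0 s1 (by simp) (by simp [hs1])
    have r6 := rd 6 (by omega) 1 s3 (by simp) (by simp [hs3])
    have r7 := rd 7 (by omega) 0 s3 (by simp) (by simp [hs3])
    rcases m1 with h1 | h1 <;> rcases m3 with h3 | h3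
    · exact absurd (h1.trans h3.symm) hne
    · exfalso
      have e1 : t1 = s1 := Fin.ext (h1.trans hs1.symm)
      apply d23
      rw [r2, r3, ← ht1, e1]
    · have e1 : t1 = s3 := Fin.ext (h1.trans hs3.symm)
      have e3 : t3 = s1 := Fin.ext (h3.trans hs1.symm)
      refine ⟨?_, ?_⟩
      · rw [r3, r7, ← ht1, e1]
      · rw [r6, r2, ← ht3, e3]
    · exact absurd (h1.trans h3.symm) hne
  -- the letters `2`, `3` once in block `0`, and the colour sum of block `0`
  have hind : ∀ c, 2 ≤ c → c < 4 →
      (if U 0 = c then 1 else 0) + (if U 2 = c then 1 else 0) + (if U 5 = c then 1 else 0) +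
        (if U 7 = c then 1 else 0) = 1 := by
    intro c hc hc'
    have h : ∑ s : Fin N, (if ((g (σ 0 s) : Fin N) : ℕ) = c then 1 else 0) = 1 := by
      rw [Equiv.sum_comp (σ 0) (fun x => if ((g x : Fin N) : ℕ) = c then 1 else 0)]
      exact sum_quadIndicator_eq hN (fun i => ((g i : Fin N) : ℕ)) hgv c hc hc'
    rw [sum_slots_quad_eq hN _ (fun s hs => by
      have h0 : U (2 * s) = 0 := harm (P (2 * s)) (by rw [hP _ (by omega)]; omega)
      rw [← rd (2 * s) (by omega) 0 s (by split_ifs <;> omega) (by split_ifs <;> omega), h0]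
      rw [if_neg (by omega)])] at h
    rw [dif_pos (by omega), dif_pos (by omega), dif_pos (by omega), dif_pos (by omega)] at h
    rw [← rd 0 (by omega) 0 ⟨0, by omega⟩ (by simp) (by simp), ← rd 2 (by omega) 0 ⟨1, by omega⟩ (by simp) (by simp),
      ← rd 5 (by omega) 0 ⟨2, by omega⟩ (by simp) (by simp), ← rd 7 (by omega) 0 ⟨3, by omega⟩ (by simp) (by simp)] at h
    have hp : ∀ j ∈ Finset.range k,
        ((if hj : 2 * j + 4 < N then (if ((g (σ 0 ⟨2 * j + 4, hj⟩) : Fin N) : ℕ) = c then 1 else 0) else 0) +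
         (if hj : 2 * j + 5 < N then (if ((g (σ 0 ⟨2 * j + 5, hj⟩) : Fin N) : ℕ) = c then 1 else 0) else 0)) = 0 := by
      intro j hj
      rw [Finset.mem_range] at hj
      rw [dif_pos (by omega), dif_pos (by omega),
        ← rd (4 * j + 8) (by omega) 0 ⟨2 * j + 4, by omega⟩ (by split_ifs <;> simp <;> omega)
          (by split_ifs <;> simp <;> omega),
        ← rd (4 * j + 11) (by omega) 0 ⟨2 * j + 5, by omega⟩ (by split_ifs <;> simp <;> omega)
          (by split_ifs <;> simp <;> omega)]
      have := hU2 (4 * j + 8) (by omega) (by omega); have := hU2 (4 * j + 11) (by omega) (by omega)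
      rw [if_neg (by omega), if_neg (by omega)]
    rw [Finset.sum_congr rfl hp] at h
    simpa using h
  obtain ⟨eA2, xA2⟩ := indicator4_once (hind 2 (by omega) (by omega))
  obtain ⟨eA3, xA3⟩ := indicator4_once (hind 3 (by omega) (by omega))
  have hsumA : U 0 + U 2 + U 5 + U 7 + ∑ j ∈ Finset.range k, (U (4 * j + 8) + U (4 * j + 11)) = k + 6 := by
    have hgsum : ∑ i : Fin N, ((g i : Fin N) : ℕ) = k + 6 := sum_quadColouring_eq hN _ hgv
    rw [← Equiv.sum_comp (σ 0) (fun x => ((g x : Fin N) : ℕ))] at hgsum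
    rw [sum_slots_quad_eq hN (fun s => ((g (σ 0 s) : Fin N) : ℕ)) (fun s hs => by
      have h0 : U (2 * s) = 0 := harm (P (2 * s)) (by rw [hP _ (by omega)]; omega)
      rw [← rd (2 * s) (by omega) 0 s (by split_ifs <;> omega) (by split_ifs <;> omega), h0])] at hgsum
    rw [dif_pos (by omega), dif_pos (by omega), dif_pos (by omega), dif_pos (by omega)] at hgsum
    rw [← rd 0 (by omega) 0 ⟨0, by omega⟩ (by simp) (by simp), ← rd 2 (by omega) 0 ⟨1, by omega⟩ (by simp) (by simp),
      ← rd 5 (by omega) 0 ⟨2, by omega⟩ (by simp) (by simp), ← rd 7 (by omega) 0 ⟨3, by omega⟩ (by simp) (by simp)]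
      at hgsum
    have hp : ∀ j ∈ Finset.range k,
        ((if hj : 2 * j + 4 < N then ((g (σ 0 ⟨2 * j + 4, hj⟩) : Fin N) : ℕ) else 0) +
         (if hj : 2 * j + 5 < N then ((g (σ 0 ⟨2 * j + 5, hj⟩) : Fin N) : ℕ) else 0)) =
          U (4 * j + 8) + U (4 * j + 11) := by
      intro j hj
      rw [Finset.mem_range] at hj
      rw [dif_pos (by omega), dif_pos (by omega),
        ← rd (4 * j + 8) (by omega) 0 ⟨2 * j + 4, by omega⟩ (by split_ifs <;> simp <;> omega)
          (by split_ifs <;> simp <;> omega),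
        ← rd (4 * j + 11) (by omega) 0 ⟨2 * j + 5, by omega⟩ (by split_ifs <;> simp <;> omega)
          (by split_ifs <;> simp <;> omega)]
    rw [Finset.sum_congr rfl hp] at hgsum
    omega
  -- the front pair: twin or anti-twin
  have hfront := quadFront_local_configurations (U 0) (U 1) (U 2) (U 3) (U 4) (U 5) (U 6) (U 7) (hU4 0) (hU4 1)
    (hU4 2) (hU4 3) (hU4 4) (hU4 5) d01 d02 d03 d12 d13 d23 d45 d46 d47 d56 d57 v1 v3 eA2 eA3 xA2 xA3
  -- the pairs: parity law with remainder
  have hcase : ∀ j < k, (U (4 * j + 10) = U (4 * j + 8) ∧ U (4 * j + 11) + U (4 * j + 8) = 1) ∨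
      (U (4 * j + 10) ≠ U (4 * j + 8) ∧ U (4 * j + 11) = U (4 * j + 8)) := by
    intro j hj
    have := hc0 j hj; have := hc1 j hj; have := hU2 (4 * j + 8) (by omega) (by omega)
    have := hU2 (4 * j + 10) (by omega) (by omega)
    by_cases h : U (4 * j + 10) = U (4 * j + 8)
    · left; exact ⟨h, by omega⟩
    · right; exact ⟨h, by omega⟩
  have hpar := antiPairs_card_add_sum k (fun j => U (4 * j + 8)) (fun j => U (4 * j + 11)) (fun j => U (4 * j + 10)) hcase
  set L := ((Finset.range k).filter (fun j => U (4 * j + 10) ≠ U (4 * j + 8))).toList with hL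
  have hLnd : L.Nodup := Finset.nodup_toList _
  have hLmem : ∀ j, j ∈ L ↔ j < k ∧ U (4 * j + 10) ≠ U (4 * j + 8) := by
    intro j; rw [hL, Finset.mem_toList, Finset.mem_filter, Finset.mem_range]
  have hLlen : L.length = ((Finset.range k).filter (fun j => U (4 * j + 10) ≠ U (4 * j + 8))).card := by
    rw [hL, Finset.length_toList]
  -- the correcting column permutation on the pairs
  let a : ℕ → Fin (N * 2) := fun j => P (4 * j + 10)
  let b : ℕ → Fin (N * 2) := fun j => P (4 * j + 11)
  have hav : ∀ j, j < k → ((a j : Fin (N * 2)) : ℕ) = 4 * j + 10 := fun j hj => hP _ (by omega)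
  have hbv : ∀ j, j < k → ((b j : Fin (N * 2)) : ℕ) = 4 * j + 11 := fun j hj => hP _ (by omega)
  have hLk : ∀ j ∈ L, j < k := fun j hj => ((hLmem j).1 hj).1
  have hab : ∀ i ∈ L, ∀ j ∈ L, a i ≠ b j := by
    intro i hi j hj h
    have := congrArg Fin.val h; rw [hav i (hLk i hi), hbv j (hLk j hj)] at this; omega
  have ha : ∀ i ∈ L, ∀ j ∈ L, a i = a j → i = j := by
    intro i hi j hj h
    have := congrArg Fin.val h; rw [hav i (hLk i hi), hav j (hLk j hj)] at this; omega
  have hb : ∀ i ∈ L, ∀ j ∈ L, b i = b j → i = j := by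
    intro i hi j hj h
    have := congrArg Fin.val h; rw [hbv i (hLk i hi), hbv j (hLk j hj)] at this; omega
  set qp : Equiv.Perm (Fin (N * 2)) := (L.map fun j => Equiv.swap (a j) (b j)).prod with hqp
  obtain ⟨hq1, hq2⟩ := swapList_apply_pair a b L hLnd hab ha hb
  have hsqp : Equiv.Perm.sign qp = (-1) ^ L.length := by
    rw [hqp, sign_swapList a b L (fun j hj => hab j hj j hj)]
  have hqfix : ∀ p : Fin (N * 2), ¬ (8 ≤ (p : ℕ) ∧ (p : ℕ) < 4 * k + 8 ∧ 2 ≤ (p : ℕ) % 4 ∧ ((p : ℕ) - 8) / 4 ∈ L) →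
      qp p = p := by
    intro p hp
    apply hq2
    intro j hj
    have hjk := hLk j hj
    constructor
    · intro h
      have := congrArg Fin.val h; rw [hav j hjk] at this
      exact hp ⟨by omega, by omega, by omega, by rw [show ((p : ℕ) - 8) / 4 = j by omega]; exact hj⟩
    · intro h
      have := congrArg Fin.val h; rw [hbv j hjk] at this
      exact hp ⟨by omega, by omega, by omega, by rw [show ((p : ℕ) - 8) / 4 = j by omega]; exact hj⟩
  have hqpC : qp ∈ T.colStab := by
    rw [StdFilling.mem_colStab]
    intro p
    by_cases hp : 8 ≤ (p : ℕ) ∧ (p : ℕ) < 4 * k + 8 ∧ 2 ≤ (p : ℕ) % 4 ∧ ((p : ℕ) - 8) / 4 ∈ L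
    · obtain ⟨hp1, hp2, hp3, hp4⟩ := hp
      have hjk : ((p : ℕ) - 8) / 4 < k := by omega
      rcases (show (p : ℕ) % 4 = 2 ∨ (p : ℕ) % 4 = 3 by omega) with h0 | h1
      · have hpa : p = a (((p : ℕ) - 8) / 4) := Fin.ext (by rw [hav _ hjk]; omega)
        have e1 := (hq1 _ hp4).1
        rw [← hpa] at e1
        rw [e1, hcolT, hcolT, hbv _ hjk]
        rw [if_neg (by omega), if_pos (by omega), if_neg (by omega), if_pos hp2]
        omega
      · have hpb : p = b (((p : ℕ) - 8) / 4) := Fin.ext (by rw [hbv _ hjk]; omega)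
        have e1 := (hq1 _ hp4).2
        rw [← hpb] at e1
        rw [e1, hcolT, hcolT, hav _ hjk]
        rw [if_neg (by omega), if_pos (by omega), if_neg (by omega), if_pos hp2]
        omega
    · rw [hqfix p hp]
  -- positions `4, 5`
  obtain ⟨p4, hp4⟩ : ∃ p : Fin (N * 2), (p : ℕ) = 4 := ⟨⟨4, by omega⟩, rfl⟩
  obtain ⟨p5, hp5⟩ : ∃ p : Fin (N * 2), (p : ℕ) = 5 := ⟨⟨5, by omega⟩, rfl⟩
  have hq4 : qp p4 = p4 := hqfix p4 (fun h => by omega)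
  have hq5 : qp p5 = p5 := hqfix p5 (fun h => by omega)
  -- the front correction `t ∈ {1, (4 5)}` making `qp * t` even, with the values at `4, 5` after correction
  obtain ⟨t, htC, hsign, htfix, ht4, ht5⟩ : ∃ t : Equiv.Perm (Fin (N * 2)), t ∈ T.colStab ∧
      Equiv.Perm.sign (qp * t) = 1 ∧ (∀ p : Fin (N * 2), (p : ℕ) ≠ 4 → (p : ℕ) ≠ 5 → t p = p) ∧
      ((v (qp (t p4)) : Fin N) : ℕ) = U 0 ∧ ((v (qp (t p5)) : Fin N) : ℕ) = U 1 := by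
    rcases hfront with ⟨t40, t51⟩ | ⟨t41, t50, t01⟩
    · -- front twin: the number of anti pairs is even
      have hU0123 : U 0 + U 2 + U 5 + U 7 = 6 := by
        have := hU4 0; have := hU4 1; have := hU4 2; have := hU4 3; omega
      have hev : Even L.length := by
        rw [hLlen]; exact ⟨∑ j ∈ (Finset.range k).filter (fun j => U (4 * j + 10) ≠ U (4 * j + 8)), U (4 * j + 8),
          by omega⟩
      refine ⟨1, StdFilling.one_mem_colStab T, ?_, fun p _ _ => rfl, ?_, ?_⟩
      · rw [mul_one, hsqp]; exact Even.neg_one_pow hev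
      · show ((v (qp p4) : Fin N) : ℕ) = U 0; rw [hq4, hUp, hp4]; exact t40
      · show ((v (qp p5) : Fin N) : ℕ) = U 1; rw [hq5, hUp, hp5]; exact t51
    · -- front anti-twin: the number of anti pairs is odd
      have hU23 : U 2 + U 3 = 5 := by
        have := hU4 2; have := hU4 3; omega
      have hodd : Odd L.length := by
        rw [hLlen]
        exact ⟨∑ j ∈ (Finset.range k).filter (fun j => U (4 * j + 10) ≠ U (4 * j + 8)), U (4 * j + 8) + U 0 - 1,
          by omega⟩
      have h45 : p4 ≠ p5 := fun h => by have := congrArg Fin.val h; omega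
      refine ⟨Equiv.swap p4 p5, ?_, ?_, ?_, ?_, ?_⟩
      · exact StdFilling.swap_mem_colStab (by rw [hcolT, hcolT, hp4, hp5]; simp)
      · have h1 : Equiv.Perm.sign qp = -1 := by rw [hsqp]; exact Odd.neg_one_pow hodd
        rw [Equiv.Perm.sign_mul, h1, Equiv.Perm.sign_swap h45]; decide
      · intro p h4' h5'
        exact Equiv.swap_apply_of_ne_of_ne (fun h => h4' (by rw [h, hp4])) (fun h => h5' (by rw [h, hp5]))
      · rw [Equiv.swap_apply_left, hq5, hUp, hp5]; exact t50
      · rw [Equiv.swap_apply_right, hq4, hUp, hp4]; exact t41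
  set q : Equiv.Perm (Fin (N * 2)) := qp * t with hq
  have hqC : q ∈ T.colStab := StdFilling.mul_mem_colStab hqpC htC
  have hqv : ∀ p, q p = qp (t p) := fun p => rfl
  have hqfix' : ∀ p : Fin (N * 2), ((p : ℕ) < 4 ∨ 4 * k + 8 ≤ (p : ℕ) ∨
      (8 ≤ (p : ℕ) ∧ (p : ℕ) < 4 * k + 8 ∧ (p : ℕ) % 4 < 2)) → q p = p := by
    intro p hp
    rw [hqv, htfix p (by omega) (by omega)]
    exact hqfix p (fun h => by omega)
  -- `v ∘ q` is a twin word
  have htw : T.polytabloid ℂ hNY (v ∘ ⇑q) = 1 := by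
    apply quadFrontTableau_twin_eq_one hNY T hT (by omega)
    · intro p hp
      show ((v (q p) : Fin N) : ℕ) = 0
      rw [hqfix' p (Or.inr (Or.inl hp))]; exact harm p hp
    · intro p hp; exact hlt4 _
    · intro p h8 hp hr
      show ((v (q p) : Fin N) : ℕ) < 2
      rw [hqfix' p (Or.inr (Or.inr ⟨h8, hp, hr⟩))]; exact hlt2 _ h8
    · intro p p' hp hp' hpp
      have h : v (q p) = v (q p') := hpp
      rw [hqfix' p (Or.inl hp), hqfix' p' (Or.inl hp')] at h
      exact hinj p p' (by rw [hcolT, hcolT, if_pos (by omega), if_pos (by omega)]; omega) h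
    · intro p p' h8 hp h8' hp' hr hr' hbase hpp
      have h : v (q p) = v (q p') := hpp
      rw [hqfix' p (Or.inr (Or.inr ⟨h8, hp, hr⟩)), hqfix' p' (Or.inr (Or.inr ⟨h8', hp', hr'⟩))] at h
      exact hinj p p' (by
        rw [hcolT, hcolT, if_neg (by omega), if_pos hp, if_neg (by omega), if_pos hp']; omega) h
    · intro p hp
      show v (q _) = v (q p)
      rw [hqfix' p (Or.inl hp)]
      apply Fin.ext
      rw [hUp p]
      rcases (show (p : ℕ) = 0 ∨ (p : ℕ) = 1 ∨ (p : ℕ) = 2 ∨ (p : ℕ) = 3 by omega) with h0 | h1 | h2 | h3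
      · rw [show (⟨(p : ℕ) + 4, by omega⟩ : Fin (N * 2)) = p4 from Fin.ext (by rw [hp4]; show (p : ℕ) + 4 = 4; omega),
          hqv, ht4, h0]
      · rw [show (⟨(p : ℕ) + 4, by omega⟩ : Fin (N * 2)) = p5 from Fin.ext (by rw [hp5]; show (p : ℕ) + 4 = 5; omega),
          hqv, ht5, h1]
      · rw [hqv, htfix _ (by dsimp only; omega) (by dsimp only; omega),
          hqfix _ (fun h => by dsimp only at h; omega), hUp]
        show U ((p : ℕ) + 4) = U (p : ℕ)
        rw [h2]; exact v3
      · rw [hqv, htfix _ (by dsimp only; omega) (by dsimp only; omega),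
          hqfix _ (fun h => by dsimp only at h; omega), hUp]
        show U ((p : ℕ) + 4) = U (p : ℕ)
        rw [h3]; exact v1.symm
    · intro p h8 hp hr
      show v (q _) = v (q p)
      rw [hqfix' p (Or.inr (Or.inr ⟨h8, hp, hr⟩)), hqv, htfix _ (by dsimp only; omega)
        (by dsimp only; omega)]
      obtain ⟨j, hj⟩ : ∃ j : ℕ, ((p : ℕ) - 8) / 4 = j := ⟨_, rfl⟩
      have hjk : j < k := by omega
      have hc0j := hc0 j hjk
      have hc1j := hc1 j hjk
      have hU8 := hU2 (4 * j + 8) (by omega) (by omega)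
      have hU10 := hU2 (4 * j + 10) (by omega) (by omega)
      apply Fin.ext
      rw [hUp p]
      by_cases hjL : j ∈ L
      · have hanti := ((hLmem j).1 hjL).2
        rcases (show (p : ℕ) % 4 = 0 ∨ (p : ℕ) % 4 = 1 by omega) with h0 | h1
        · have hpa : (⟨(p : ℕ) + 2, by omega⟩ : Fin (N * 2)) = a j :=
            Fin.ext (by show (p : ℕ) + 2 = _; rw [hav j hjk]; omega)
          rw [hpa, (hq1 j hjL).1, show (p : ℕ) = 4 * j + 8 by omega]
          show U (4 * j + 11) = U (4 * j + 8)
          omega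
        · have hpb : (⟨(p : ℕ) + 2, by omega⟩ : Fin (N * 2)) = b j :=
            Fin.ext (by show (p : ℕ) + 2 = _; rw [hbv j hjk]; omega)
          rw [hpb, (hq1 j hjL).2, show (p : ℕ) = 4 * j + 9 by omega]
          show U (4 * j + 10) = U (4 * j + 9)
          omega
      · have htwin : U (4 * j + 10) = U (4 * j + 8) := by
          by_contra h; exact hjL ((hLmem j).2 ⟨hjk, h⟩)
        rw [hqfix _ (fun h => hjL (by rw [show j = (((p : ℕ) + 2) - 8) / 4 by omega]; simpa using h.2.2.2)), hUp]
        show U ((p : ℕ) + 2) = U (p : ℕ)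
        rcases (show (p : ℕ) % 4 = 0 ∨ (p : ℕ) % 4 = 1 by omega) with h0 | h1
        · rw [show (p : ℕ) + 2 = 4 * j + 10 by omega, show (p : ℕ) = 4 * j + 8 by omega]
          exact htwin
        · rw [show (p : ℕ) + 2 = 4 * j + 11 by omega, show (p : ℕ) = 4 * j + 9 by omega]
          omega
  -- `e_T(v ∘ q) = sgn(q) · e_T(v)`
  have key := congrFun (StdFilling.wordPerm_polytabloid_of_mem_colStab (k := ℂ) hNY T hqC) v
  rw [wordPerm_apply, Pi.smul_apply, smul_eq_mul, hsign, htw] at key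
  simpa using key.symm

end Summit.MatrixMultiplication.MatrixMultiplication.Theorems.ObstructionCalculus
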